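import Literature.AlgebraicGeometry.AbelianSchemes.WeilUnitKernelIsotropicOfDescent   -- ★ (ISO-q) `weilUnit_comp_lam_eq_one_of_comp_eq_one` + §0 plumbing
import HarnessLib

/-!
# The SHIFTED isotropy of the kernel of a polarised isogeny: `e_n(x, λ y) = 1` for `x ∈ Ker q ∩ A[n]` and `m·y ∈ Ker q`, when `p·λ` descends through `q` and `n = p·m`
# ([Mumford AV] §23 Thm. 2 (p. 231), §20 (I) (p. 186); [Milne AV] I §13)

Topic `Literature/AlgebraicGeometry/AbelianSchemes`; namespace `Literature.AlgebraicGeometry.AbelianSchemes.AbelianSchemeOver.DualPair` (sibling of ★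
`WeilUnitKernelIsotropicOfDescent`, which is the case `m = 1`).  THEOREMS ONLY (no definition, no named fact, no instance, no notation, no `sorry`).
Cell `hodgecm-mathlib` (D-0151), P6 «MOD programme» (crux hLiu418 = stmt-HodgeConjecture-24832, `--supports`, count-neutral), half-A line L3 (socket
`stub_ROOF0`, (rL-asm) `w`-block): the PAIRING CORE of the isotropy input (I-iso) of the (KW) socket of the `w`-block congruence relation (W-DOCK
`WBlockLaw.rL_W'`, binder `hKW`; F0P6b-plan (g5) ED. 4 organ `hKW_of_isotropy_of_finrank`), where the shift is `m = p^{r−1}`, `n = q = p^r` and the descent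
row is the reduced square law (r3₀-q) `q̄ ≫ λ_B̄ ≫ q̄^∨ = λ ≫ [p]`.  HONEST LABEL: HC_CM is proved only modulo the 2 remaining named inputs (hLiu418 24832,
h413 24833) until rung 0 closes; this file is generic and discharges none of them.

THE MATHEMATICS.  Let `q : A → C` be a homomorphism of abelian `S`-schemes, `λ : A → Â`, `λ_C : C → Ĉ` homomorphisms with the DESCENT ROW
`q ≫ λ_C ≫ q^∨ = λ ≫ [p]_Â` (★ `dualIsogenyOver`, ★ `mulN`), and `n = p·m`.  For an `n`-torsion section `x` of `A_T` killed by `q_T` and a `T`-point `y` of `A`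
with `m·y` killed by `q`: `e_n(x, λ y) = 1`.  Indeed `[p] : A_T → A_T` is an fppf epimorphism, so on the finite flat cover `T′ := T ×_{y, A_T, [p]} A_T → T`
there is `y′` with `p·y′ = y|_{T′}`; then `λ(y|_{T′}) = (λ ≫ [p])(y′) = q^∨(λ_C(q y′))` with `c′ := λ_C(q y′)` an `n`-TORSION point of `Ĉ`
(`n·c′ = λ_C q (m·(p·y′)) = λ_C q (m·y) = 0` — this is where `m·y ∈ Ker q` enters), so ★ `weilUnit_comp_dualIsogenyOver_eq_one_of_comp_baseChangeHom_eq_one`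
(«`Ker q ⟂ q^∨(Ĉ[n])`», [MumfordAV1970] §20 (I)) gives `e_n(x, λ y)|_{T′} = 1` (★ `weilUnit_baseChange`), and a unit of `Γ(T, 𝒪_T)` that becomes `1` on a
faithfully flat cover is `1` (★ `appTop_injective_of_epi`).  With [MumfordAV1970] §20 p. 186's level shift `e_{pm}(x, ĉ) = e_p(x, ĉ^m)` (`x ∈ A[p]`) this is
§23 Thm. 2 at level `p` applied to `(x, m·y)`; the present proof avoids the level shift.

* §1 **`weilUnit_comp_lam_eq_one_of_mulN_comp_eq_one`** — THE HEAD over a reduced locally Noetherian base.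
* §2 **`weilChar_comp_lam_eq_one_of_mulN_comp_eq_one`** — over a field, on points with values in a finite `k`-algebra (★ `weilChar` currency, the one in
  which ★ `WeilPairingHom.exists_weilHom` characterises the Weil homomorphism `w : Â[n] → A[n]^D`).

## References
* [MumfordAV1970] D. Mumford, *Abelian Varieties* (1970), §23 Thm. 2 (p. 231), §20 (I) (p. 186), (IV) (p. 187), §15 Thm. 1 (p. 143).
* [MilneAV2008] J. S. Milne, *Abelian Varieties* (2008), I §11, I §13 (the `e^λ_n`-pairing).
* [GortzWedhorn2020] U. Görtz, T. Wedhorn, *Algebraic Geometry I*, 2nd ed. (2020), Section (4.7) (p. 108); (14.20) (fpqc descent of sections).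
-/

set_option autoImplicit false

noncomputable section

-- `TopCat.Presheaf`/`Scheme.Modules` are not reducible (as in ★ `WeilUnitOfTorsionPoint`, ★ `WeilUnitKernelIsotropicOfDescent`).
set_option backward.isDefEq.respectTransparency false

universe u

open CategoryTheory CategoryTheory.Limits AlgebraicGeometry MonoidalCategory CartesianMonoidalCategory TopologicalSpace
  Opposite
open scoped MonObj

namespace Literature.AlgebraicGeometry.AbelianSchemes.AbelianSchemeOver.DualPair

open TorsionPairing Literature.AlgebraicGeometry.RelativeSpec Literature.AlgebraicGeometry.Modules Literature.AlgebraicGeometry.Motives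
  Literature.AlgebraicGeometry.RelativeSpec.ActionOver

/-! ## §1 The head: shifted isotropy over a reduced locally Noetherian base -/

section Descent

variable {S : Scheme.{u}} {A C : AbelianSchemeOver S} [IsReduced S] [IsLocallyNoetherian S] (q : A.X ⟶ C.X) [IsMonHom q]
  (DA : A.DualPair) (DC : C.DualPair)
  (hDA : Nonempty ((Scheme.Modules.pullback (DualPair.unitHatSlice DA)).obj DA.P ≅ SheafOfModules.unit _))
  (hDC : Nonempty ((Scheme.Modules.pullback (DualPair.unitHatSlice DC)).obj DC.P ≅ SheafOfModules.unit _)) (n p m : ℕ)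
  (lam : A.X ⟶ DA.hat.X) [IsMonHom lam] (lamC : C.X ⟶ DC.hat.X) [IsMonHom lamC]
  {T : Scheme.{u}} (f : T ⟶ S) [IsLocallyNoetherian T] [IsCommMonObj A.X] [IsCommMonObj C.X]
  [IsCommMonObj (A.baseChange f).X] [IsCommMonObj (C.baseChange f).X]

include hDC in
/-- **SHIFTED ISOTROPY OF `Ker q` FOR `e_n(·, λ ·)` WHEN `p·λ` DESCENDS THROUGH `q` AND `n = p·m`** ([MumfordAV1970] §23 Thm. 2 + §20 p. 186, scheme-theoretically,
without theta groups and without the level shift): if `q ≫ λ_C ≫ q^∨ = λ ≫ [p]_Â`, `p · m = n ≠ 0`, then for every `n`-torsion section `x` of `A_T` killed by `q_T`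
and every `T`-point `y` of `A` with `m·y` killed by `q` (`y ≫ [m] ≫ q = 1`), `e_n^A(x, y ≫ λ) = 1`.  (fppf-locally `y = p·y′`, so `λ y = q^∨(λ_C(q y′))` with
`λ_C(q y′) ∈ Ĉ[n]` because `n·λ_C(q y′) = λ_C(q(m·y)) = 1`, and ★ `Ker q ⟂ q^∨(Ĉ[n])`; units descend along the finite flat cover `[p]`.)  The torsion witness `hc`
of `y ≫ λ` is a free hypothesis (it holds: `(y ≫ λ)^n = y ≫ [m] ≫ q ≫ λ_C ≫ q^∨ = 1`).  The case `m = 1` is ★ `weilUnit_comp_lam_eq_one_of_comp_eq_one`.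
[cite: MumfordAV1970, §23 Thm. 2 (p. 231); §20 (I) (p. 186)] [cite: MilneAV2008, I §13] -/
theorem weilUnit_comp_lam_eq_one_of_mulN_comp_eq_one (hn : n ≠ 0) (hpm : p * m = n)
    (r3 : q ≫ lamC ≫ dualIsogenyOver q DA DC = lam ≫ DA.hat.mulN p)
    (x : (A.baseChange f).torsionSections n) (hx : (x : (A.baseChange f).Sections) ≫ baseChangeHom q f = 1)
    (y : Over.mk f ⟶ A.X) (hy : y ≫ A.mulN m ≫ q = 1) (hc : (y ≫ lam) ^ n = 1) :
    DA.weilUnit hDA n f (y ≫ lam) hc x = 1 := by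
  have hp : p ≠ 0 := by
    rintro rfl
    exact hn (by rw [← hpm, zero_mul])
  -- (1) the finite flat cover `t : T′ → T` on which `y` becomes divisible by `p`
  let sy : (A.baseChange f).Sections := A.ptSection f y
  haveI : IsFinite ((A.baseChange f).mulN p).left := (A.baseChange f).isFinite_pow_id_left_of_ne_zero hp
  haveI : Flat ((A.baseChange f).mulN p).left := (A.baseChange f).flat_pow_id_left_of_ne_zero hp
  haveI : Surjective ((A.baseChange f).mulN p).left := (A.baseChange f).surjective_pow_id_left_of_ne_zero hp
  let t : pullback sy.left ((A.baseChange f).mulN p).left ⟶ T := pullback.fst sy.left ((A.baseChange f).mulN p).left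
  let y₀ : pullback sy.left ((A.baseChange f).mulN p).left ⟶ (A.baseChange f).X.left := pullback.snd sy.left ((A.baseChange f).mulN p).left
  have hcond : t ≫ sy.left = y₀ ≫ ((A.baseChange f).mulN p).left := pullback.condition
  haveI : IsFinite t := MorphismProperty.pullback_fst _ _ inferInstance
  haveI : Flat t := MorphismProperty.pullback_fst _ _ inferInstance
  haveI : Surjective t := MorphismProperty.pullback_fst _ _ inferInstance
  haveI : Epi t := Flat.epi_of_flat_of_surjective t
  haveI : IsLocallyNoetherian (pullback sy.left ((A.baseChange f).mulN p).left) := LocallyOfFiniteType.isLocallyNoetherian t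
  haveI : IsCommMonObj (A.baseChange (t ≫ f)).X := isCommMonObj_baseChange _
  haveI : IsCommMonObj (C.baseChange (t ≫ f)).X := isCommMonObj_baseChange _
  -- (2) the `p`-th root `y′` of `y` over `T′`
  have hy₀T : y₀ ≫ (A.baseChange f).X.hom = t := by
    have h1 : y₀ ≫ (A.baseChange f).X.hom = (y₀ ≫ ((A.baseChange f).mulN p).left) ≫ (A.baseChange f).X.hom := by
      rw [Category.assoc, Over.w]
    rw [h1, ← hcond, Category.assoc, Over.w sy]
    exact Category.comp_id _
  let y' : Over.mk (t ≫ f) ⟶ A.X := Over.homMk (y₀ ≫ pullback.fst A.X.hom f) (by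
    change (y₀ ≫ pullback.fst A.X.hom f) ≫ A.X.hom = t ≫ f
    rw [Category.assoc, pullback.condition, ← Category.assoc]
    exact congrArg (· ≫ f) hy₀T)
  have key1 : y' ≫ A.mulN p = pointAlong f t y := by
    ext1
    change (y₀ ≫ pullback.fst A.X.hom f) ≫ (A.mulN p).left = t ≫ y.left
    rw [Category.assoc, ← baseChangeHom_left_comp_fst (A.mulN p) f, baseChangeHom_mulN A f p, ← Category.assoc, ← hcond,
      Category.assoc]
    exact congrArg (t ≫ ·) (A.ptSection_left_fst f y)
  -- (3) the `n`-torsion point `c′ := λ_C (q y′)` of `Ĉ` with `q^∨ c′ = λ y` over `T′`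
  let c' : Over.mk (t ≫ f) ⟶ DC.hat.X := y' ≫ q ≫ lamC
  have hmulC : C.mulN n ≫ lamC = lamC ≫ DC.hat.mulN n := by
    rw [mulN_def, mulN_def, MonObj.pow_comp, MonObj.comp_pow, Category.id_comp, Category.comp_id]
  have hmulA : A.mulN n ≫ q = q ≫ C.mulN n := by
    rw [mulN_def, mulN_def, MonObj.pow_comp, MonObj.comp_pow, Category.id_comp, Category.comp_id]
  have hmulL : A.mulN p ≫ lam = lam ≫ DA.hat.mulN p := by
    rw [mulN_def, mulN_def, MonObj.pow_comp, MonObj.comp_pow, Category.id_comp, Category.comp_id]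
  -- `[n]_A = [p]_A ≫ [m]_A`
  have hmulApm : A.mulN n = A.mulN p ≫ A.mulN m := by
    rw [mulN_def, mulN_def, mulN_def, MonObj.comp_pow, Category.comp_id, ← pow_mul, hpm]
  have hc'n : c' ^ n = 1 := by
    have h1 : c' ^ n = c' ≫ DC.hat.mulN n := by
      change c' ^ n = c' ≫ (𝟙 DC.hat.X) ^ n
      rw [MonObj.comp_pow, Category.comp_id]
    rw [h1]
    change (y' ≫ q ≫ lamC) ≫ DC.hat.mulN n = 1
    rw [Category.assoc, Category.assoc, ← hmulC, ← Category.assoc q, ← hmulA, ← Category.assoc, ← Category.assoc, hmulApm,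
      ← Category.assoc y', key1]
    change ((((Over.homMk t rfl : Over.mk (t ≫ f) ⟶ Over.mk f) ≫ y) ≫ A.mulN m) ≫ q) ≫ lamC = 1
    rw [Category.assoc _ y, Category.assoc _ (y ≫ A.mulN m) q, Category.assoc y, hy, MonObj.comp_one, MonObj.one_comp]
  have key3 : c' ≫ dualIsogenyOver q DA DC = pointAlong f t (y ≫ lam) := by
    change (y' ≫ q ≫ lamC) ≫ dualIsogenyOver q DA DC = (Over.homMk t rfl : Over.mk (t ≫ f) ⟶ Over.mk f) ≫ y ≫ lam
    rw [Category.assoc, Category.assoc, r3, ← hmulL, ← Category.assoc, key1, Category.assoc]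
  have hc'' : (c' ≫ dualIsogenyOver q DA DC) ^ n = 1 := by
    rw [key3]
    exact pointAlong_pow_eq_one f t (y ≫ lam) hc
  -- (4) `x` along `t` is still killed by `q`
  have hx' : ((A.torsionSectionAlong n f t x : (A.baseChange (t ≫ f)).torsionSections n) : (A.baseChange (t ≫ f)).Sections) ≫
      baseChangeHom q (t ≫ f) = 1 := by
    rw [coe_torsionSectionAlong, sectionAlong_comp_baseChangeHom, hx, map_one]
  -- (5) ★ `Ker q ⟂ q^∨(Ĉ[n])` over `T′`, moved to the point `λ y` along `t`, read through ★ `weilUnit_baseChange`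
  have h5 := weilUnit_comp_dualIsogenyOver_eq_one_of_comp_baseChangeHom_eq_one q DA DC hDA hDC n (t ≫ f) c' hc'n hc''
    (A.torsionSectionAlong n f t x) hx'
  rw [DA.weilUnit_congr_point hDA n (t ≫ f) key3 hc'' (pointAlong_pow_eq_one f t (y ≫ lam) hc) (A.torsionSectionAlong n f t x),
    DA.weilUnit_baseChange hDA n f (y ≫ lam) hc t x] at h5
  -- (6) units descend along the fppf cover `t`
  exact appTop_injective_of_epi t (h5.trans (map_one t.appTop.hom).symm)

include hDC in
/-- **THE SAME WITH THE SHIFT AS A POWER `m := p^s`, LEVEL `n := p^(s+1)`** — the currency of the `w`-block congruence relation (`q = p^r`, shift `p^{r−1}`,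
descent row at `p`): for `x ∈ Ker q_T ∩ A_T[p^{s+1}]` and `y` with `p^s·y ∈ Ker q`, `e_{p^{s+1}}(x, λ y) = 1`. [cite: MumfordAV1970, §23 Thm. 2 (p. 231); §20 (I) (p. 186)] -/
theorem weilUnit_comp_lam_eq_one_of_mulN_pow_comp_eq_one (hp : p ≠ 0) (s : ℕ)
    (r3 : q ≫ lamC ≫ dualIsogenyOver q DA DC = lam ≫ DA.hat.mulN p)
    (x : (A.baseChange f).torsionSections (p ^ (s + 1))) (hx : (x : (A.baseChange f).Sections) ≫ baseChangeHom q f = 1)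
    (y : Over.mk f ⟶ A.X) (hy : y ≫ A.mulN (p ^ s) ≫ q = 1) (hc : (y ≫ lam) ^ (p ^ (s + 1)) = 1) :
    DA.weilUnit hDA (p ^ (s + 1)) f (y ≫ lam) hc x = 1 :=
  weilUnit_comp_lam_eq_one_of_mulN_comp_eq_one q DA DC hDA hDC (p ^ (s + 1)) p (p ^ s) lam lamC f (pow_ne_zero _ hp) (pow_succ' p s).symm
    r3 x hx y hy hc

end Descent

/-! ## §2 Over a field: the shifted isotropy in the `weilChar` currency (points over a finite `k`-algebra) -/

section Field

open scoped CategoryTheory.Obj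

variable {k : Type u} [Field k] {A C : AbelianSchemeOver (Spec (CommRingCat.of k))} (q : A.X ⟶ C.X) [IsMonHom q]
  (DA : A.DualPair) (DC : C.DualPair)
  (hDA : Nonempty ((Scheme.Modules.pullback (DualPair.unitHatSlice DA)).obj DA.P ≅ SheafOfModules.unit _))
  (hDC : Nonempty ((Scheme.Modules.pullback (DualPair.unitHatSlice DC)).obj DC.P ≅ SheafOfModules.unit _)) (n p m : ℕ)
  (lam : A.X ⟶ DA.hat.X) [IsMonHom lam] (lamC : C.X ⟶ DC.hat.X) [IsMonHom lamC]

include hDC in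
/-- **SHIFTED ISOTROPY IN THE WEIL-CHARACTER CURRENCY** (over a field `k`, for points with values in a finite `k`-algebra `T` — the currency of ★ `weilChar`
and of ★ `WeilPairingHom.exists_weilHom`'s characterisation `⟪ŷ ≫ w, x⟫ = χ(ŷ ≫ ĵ, x ≫ j)` of the Weil homomorphism `w : Â[n] → A[n]^D`): if
`q ≫ λ_C ≫ q^∨ = λ ≫ [p]`, `p·m = n ≠ 0`, then for `T`-points `x`, `y` of `A` with `x ∈ Ker q`, `x^n = 1` and `m·y ∈ Ker q`, the Weil character of the
`n`-torsion point `λ y` of `Â` at `x` is trivial: `χ_n(y ≫ λ, x) = 1`. [cite: MumfordAV1970, §23 Thm. 2 (p. 231); §20 (p. 184), (I) (p. 186)] [cite: MilneAV2008, I §13] -/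
theorem weilChar_comp_lam_eq_one_of_mulN_comp_eq_one (hn : n ≠ 0) (hpm : p * m = n)
    (r3 : q ≫ lamC ≫ dualIsogenyOver q DA DC = lam ≫ DA.hat.mulN p)
    {T : Type u} [CommRing T] [Algebra k T] [Module.Finite k T]
    (x : specOver k T ⟶ A.X) (hxq : x ≫ q = 1) (hx : x ^ n = 1)
    (y : specOver k T ⟶ A.X) (hy : y ≫ A.mulN m ≫ q = 1) (hc : (y ≫ lam) ^ n = 1) :
    DA.weilChar hDA n (y ≫ lam) hc x hx = 1 := by
  haveI : IsLocallyNoetherian (Spec (CommRingCat.of T)) := isLocallyNoetherian_spec_of_finite (k := k) T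
  haveI : IsLocallyNoetherian (specOver k T).left := ‹IsLocallyNoetherian (Spec (CommRingCat.of T))›
  haveI : IsCommMonObj A.X := A.isCommMonObj_of_isReduced_base
  haveI : IsCommMonObj C.X := C.isCommMonObj_of_isReduced_base
  haveI : IsCommMonObj (A.baseChange (specOver k T).hom).X := isCommMonObj_baseChange_of_field _
  haveI : IsCommMonObj (C.baseChange (specOver k T).hom).X := isCommMonObj_baseChange_of_field _
  have hsec : ((A.ptTorsionSection n (specOver k T).hom x hx : (A.baseChange (specOver k T).hom).torsionSections n) :
      (A.baseChange (specOver k T).hom).Sections) ≫ baseChangeHom q (specOver k T).hom = 1 := by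
    rw [coe_ptTorsionSection, ptSection_comp_baseChangeHom, hxq, ptSection_one]
  rw [weilChar_eq, weilUnit_comp_lam_eq_one_of_mulN_comp_eq_one q DA DC hDA hDC n p m lam lamC (specOver k T).hom hn hpm r3
    (A.ptTorsionSection n (specOver k T).hom x hx) hsec y hy hc, map_one]

end Field

end Literature.AlgebraicGeometry.AbelianSchemes.AbelianSchemeOver.DualPair

end
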